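import Summits.CriticalPhenomena.PercolationContinuityZ3.Theorems.SahiMasterFamilyPointwiseCoordinateGluingSandwichApexSettled
import Summits.CriticalPhenomena.PercolationContinuityZ3.Theorems.SahiMasterFamilyExplicitMinorDominationSingle
import Summits.CriticalPhenomena.PercolationContinuityZ3.Theorems.PercNearOneGluingNoHeavyLowerTailSahiCombMasterFamily
import Summits.CriticalPhenomena.PercolationContinuityZ3.Theorems.PercNearOneGluingNoHeavyLowerTailSahiCombMixAtoms

/-!
# The COMB LIFT of one-face domination (1-minor side): comb positivity and comb ORDER-1(3) along `e` when `U^{e←1}` is a zero flag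

Unit `prim-master-conj` (crux anchor stmt-CriticalPhenomena-4575, helper work), gen 19; memo
`run/shared/lean/prim/prim-l12/prim-master-conj/POINTWISE.md` §20.  Vocabulary: P3's `SahiComb.CombPos c F` (nonnegative tensor-Bernstein
representation of multidegree `c`), `SahiCombMix.mixC1/mixC2` (the two middle one-coordinate Bernstein coefficients ×3:
`E_3(μ_p;1_U) = s³E⁰ + s²t·mixC1 + st²·mixC2 + t³E¹`, `t = p_e`), gen 18's sandwiched-apex identity (`…CoordinateGluingSandwichApex`):
if the `1`-minor `(X,Y,G) = U^{e←1}` is a zero flag (sandwich: `K` increasing with `G ⊆ K`, `X ∩ K ⊆ G`, and the four moment relations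
`m(XY) = mXmY`, `m(XG) = mK·mX`, `m(YG) = mK·mY`, `m(XYG) = mK·mX·mY` at EVERY `p`) then `mixC2 = M` and `mixC1 = E⁰ + M + ν_Aν_Bν_C`
with gen 18's NINE-TERM CERTIFICATE `M = Cov(K,A⁰B⁰) + Cov(X,B⁰C⁰) + Cov(Y,A⁰C⁰) + m(A⁰N_BN_C) + m(N_AB⁰N_C) + m(N_AN_BC⁰) + m(N_AN_BN_C)
+ (mK − mG)[Cov(A⁰,B⁰) + ν_Aν_B]`.

THIS FILE observes that every atom of the certificate is COMB-POSITIVE as a function of the other parameters — Harris covariances of increasing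
events are `CombPos 2` (P3's `combPos_covFun`, = (M⁺-2)), probabilities and defect moments are `CombPos 1` (`combPos_ex`), products add degrees —
and draws the comb-level consequences (all proved, axioms standard):
* `combPos_mixC2_of_sandwich` — **the layer-2 comb coefficients of `U` along `e` are `≥ 0`**: `CombPos (3,…,3, 0 at e) (p ↦ mixC2)`.  Since the
  layer-3 coefficients are those of `E_3(U¹) ≡ 0`, this is the TOP HALF of comb ORDER-1(3) (INEQ-CLAIMS row COMB-M-E3: `c₂ ≥ c₃`) along `e`,
  UNCONDITIONALLY, for every increasing triple whose `e`-`1`-minor is a zero flag;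
* `combPos_mixC1_sub_of_sandwich` — `CombPos (…) (p ↦ mixC1 − E_3(μ_p;U⁰))` (= `M + ν_Aν_Bν_C`): the BOTTOM half `c₁ ≥ c₀` along `e`, unconditionally;
* **`combPos_sahiE_three_of_sandwich`** — **(M⁺-3) is INHERITED**: if the `0`-minor `U⁰` is comb-positive (off `e`) then `U` is comb-positive
  (`CombPos (3,…,3) (p ↦ E_3(μ_p; 1_U))`), by P3's cell lemma `combPos_three_mixCoord_of_coeffs`.  (Hypotheses in SANDWICH-DATA form: `K` increasing
  and ignoring `e`, `G ⊆ K`, `X ∩ K ⊆ G`, the four moment relations at every `p`; for a `ZVia` `1`-minor these are gen 18's `sandwich_moments_of_zVia`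
  with `K` the forced hull `{ω | ω ∪ (esupp X ∪ esupp Y) ∈ G}` — the discharge is left to a follow-up file.)
  So the comb-positive class at order 3 (P3's strata, HIERARCHY.md) is closed under every one-coordinate extension whose `1`-minor is a zero flag —
  the comb lift of gen 18's settled-class closure `sahiE_three_settled_of_zVia`.
HONEST FRAMING: unconditional comb statements on the zero-flag-`1`-minor class only; (M⁺-3), COMB-M-E3, `C_3` remain OPEN in general. [this work]
-/

noncomputable section

open scoped Classical

namespace Summit.CriticalPhenomena.PercolationContinuityZ3.Theorems

open Finset Function
open Literature.Combinatorics.Sahi2008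
open Literature.Probability.Percolation.DecisionTree (ind ind_of_mem ind_of_not_mem ind_nonneg)
open SahiComb SahiCombMix

namespace Pointwise

variable {ι : Type} [Fintype ι]

/-! ### 0. Plumbing: events ignoring `e`, degree bookkeeping -/

section Plumbing

omit [Fintype ι] in
/-- Intersections of events ignoring `e` ignore `e`. [folklore] -/
theorem insert_mem_iff_inter (e : ι) {S T : Set (Set ι)} (hS : ∀ ω, insert e ω ∈ S ↔ ω ∈ S) (hT : ∀ ω, insert e ω ∈ T ↔ ω ∈ T)
    (ω : Set ι) : insert e ω ∈ S ∩ T ↔ ω ∈ S ∩ T := by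
  simp only [Set.mem_inter_iff, hS ω, hT ω]

omit [Fintype ι] in
/-- Differences of events ignoring `e` ignore `e`. [folklore] -/
theorem insert_mem_iff_sdiff (e : ι) {S T : Set (Set ι)} (hS : ∀ ω, insert e ω ∈ S ↔ ω ∈ S) (hT : ∀ ω, insert e ω ∈ T ↔ ω ∈ T)
    (ω : Set ι) : insert e ω ∈ S \ T ↔ ω ∈ S \ T := by
  simp only [Set.mem_sdiff, hS ω, hT ω]

omit [Fintype ι] in
/-- The indicator of an event ignoring `e` ignores `e`. [folklore] -/
theorem ind_insert_of_iff (e : ι) {S : Set (Set ι)} (hS : ∀ ω, insert e ω ∈ S ↔ ω ∈ S) (ω : Set ι) :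
    ind S (insert e ω) = ind S ω := by
  by_cases h : ω ∈ S
  · rw [ind_of_mem h, ind_of_mem ((hS ω).2 h)]
  · rw [ind_of_not_mem h, ind_of_not_mem (fun h' => h ((hS ω).1 h'))]

/-- The probability of an event ignoring `e` does not depend on `p_e`. [folklore] -/
theorem ex_ind_update_of_iff (p : ι → unitInterval) (e : ι) (s : unitInterval) {S : Set (Set ι)}
    (hS : ∀ ω, insert e ω ∈ S ↔ ω ∈ S) :
    ex (bernoulliWeight (update p e s)) (ind S) = ex (bernoulliWeight p) (ind S) := by
  have h := ex_update_eq_of_ignores p e s (p e) (ind_insert_of_iff e hS)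
  rwa [update_eq_self] at h

omit [Fintype ι] in
/-- Degree bookkeeping: `(1,…,1) + (2,…,2) = (3,…,3)`. [folklore] -/
theorem one_add_two_eq_three : ((fun _ : ι => 1) + fun _ : ι => 2) = fun _ : ι => 3 := by
  funext i; simp

omit [Fintype ι] in
/-- Degree bookkeeping: `(1,…,1) + (1,…,1) = (2,…,2)`. [folklore] -/
theorem one_add_one_eq_two : ((fun _ : ι => 1) + fun _ : ι => 1) = fun _ : ι => 2 := by
  funext i; simp

omit [Fintype ι] in
/-- Degree bookkeeping: `(2,…,2) + (1,…,1) = (3,…,3)`. [folklore] -/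
theorem two_add_one_eq_three : ((fun _ : ι => 2) + fun _ : ι => 1) = fun _ : ι => 3 := by
  funext i; simp

/-- A probability of an event ignoring `e` is comb-positive at `(3,…,3, 0 at e)`. [this work] -/
theorem combPos_ex_ind_off (e : ι) {S : Set (Set ι)} (hS : ∀ ω, insert e ω ∈ S ↔ ω ∈ S) :
    CombPos (update (fun _ : ι => 3) e 0) (fun p => ex (bernoulliWeight p) (ind S)) :=
  (((combPos_ex_ind S).of_ignores e fun p s => ex_ind_update_of_iff p e s hS)).mono (SahiCombMix.deg_off_mono e (by norm_num))

/-- A Harris covariance of increasing events ignoring `e` is comb-positive at `(3,…,3, 0 at e)`. [this work] -/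
theorem combPos_covFun_off (e : ι) {S T : Set (Set ι)} (hSu : IsUpperSet S) (hTu : IsUpperSet T)
    (hS : ∀ ω, insert e ω ∈ S ↔ ω ∈ S) (hT : ∀ ω, insert e ω ∈ T ↔ ω ∈ T) :
    CombPos (update (fun _ : ι => 3) e 0) (covFun S T) := by
  refine (((combPos_covFun S T hSu hTu).of_ignores e fun p s => ?_)).mono (SahiCombMix.deg_off_mono e (by norm_num))
  simp only [covFun]
  rw [ex_ind_update_of_iff p e s (insert_mem_iff_inter e hS hT), ex_ind_update_of_iff p e s hS, ex_ind_update_of_iff p e s hT]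

/-- A defect moment `μ(T) − μ(S)` (`S ⊆ T`, both ignoring `e`) is comb-positive at `(1,…,1)` and ignores `e`. [this work] -/
theorem combPos_ex_sub_ex (e : ι) {S T : Set (Set ι)} (hST : S ⊆ T)
    (hS : ∀ ω, insert e ω ∈ S ↔ ω ∈ S) (hT : ∀ ω, insert e ω ∈ T ↔ ω ∈ T) :
    CombPos (fun _ : ι => 1) (fun p => ex (bernoulliWeight p) (ind T) - ex (bernoulliWeight p) (ind S)) ∧
      ∀ p s, ex (bernoulliWeight (update p e s)) (ind T) - ex (bernoulliWeight (update p e s)) (ind S)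
        = ex (bernoulliWeight p) (ind T) - ex (bernoulliWeight p) (ind S) := by
  refine ⟨(combPos_ex_ind (T \ S)).congr fun p => ex_ind_sub_of_subset _ hST, fun p s => ?_⟩
  rw [ex_ind_update_of_iff p e s hS, ex_ind_update_of_iff p e s hT]

end Plumbing

/-! ### 1. The sandwich data along `e` and the two middle Bernstein functionals -/

section Sandwich

variable (e : ι) (A B D K : Set (Set ι))

/-- **The nine atoms are comb-positive off `e`**: gen 18's middle term `M`, as a function of the parameter vector, is a nonnegative combination of
the tensor-Bernstein basis of multidegree `(3,…,3, 0 at e)`. [this work] -/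
theorem combPos_M_of_sandwich (hAu : IsUpperSet A) (hBu : IsUpperSet B) (hDu : IsUpperSet D) (hKu : IsUpperSet K)
    (hKe : ∀ ω, insert e ω ∈ K ↔ ω ∈ K) (hGK : secAt e true D ⊆ K) (hXK : secAt e true A ∩ K ⊆ secAt e true D)
    (h4 : ∀ p : ι → unitInterval, ex (bernoulliWeight p) (ind (secAt e true A ∩ secAt e true B ∩ secAt e true D)) =
      ex (bernoulliWeight p) (ind K) * ex (bernoulliWeight p) (ind (secAt e true A)) * ex (bernoulliWeight p) (ind (secAt e true B))) :
    CombPos (update (fun _ : ι => 3) e 0) (fun p =>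
      (2 * ex (bernoulliWeight p) (ind (secAt e false A ∩ secAt e false B ∩ secAt e false D))
            - ex (bernoulliWeight p) (ind (secAt e true A)) * ex (bernoulliWeight p) (ind (secAt e false B ∩ secAt e false D))
            - ex (bernoulliWeight p) (ind (secAt e true B)) * ex (bernoulliWeight p) (ind (secAt e false A ∩ secAt e false D))
            - ex (bernoulliWeight p) (ind (secAt e true D)) * ex (bernoulliWeight p) (ind (secAt e false A ∩ secAt e false B))
            + ex (bernoulliWeight p) (ind (secAt e true A)) * ex (bernoulliWeight p) (ind (secAt e true B)) * ex (bernoulliWeight p) (ind (secAt e true D)))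
          + (ex (bernoulliWeight p) (ind K) - ex (bernoulliWeight p) (ind (secAt e true D))) *
            (ex (bernoulliWeight p) (ind (secAt e true A)) *
                (ex (bernoulliWeight p) (ind (secAt e true B)) - ex (bernoulliWeight p) (ind (secAt e false B)))
              + ex (bernoulliWeight p) (ind (secAt e true B)) *
                (ex (bernoulliWeight p) (ind (secAt e true A)) - ex (bernoulliWeight p) (ind (secAt e false A))))) := by
  -- notation
  set X := secAt e true A with hXdef
  set Y := secAt e true B with hYdef
  set G := secAt e true D with hGdef
  set A0 := secAt e false A with hA0def
  set B0 := secAt e false B with hB0def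
  set C0 := secAt e false D with hC0def
  have hA0u : IsUpperSet A0 := isUpperSet_secAt e false hAu
  have hB0u : IsUpperSet B0 := isUpperSet_secAt e false hBu
  have hC0u : IsUpperSet C0 := isUpperSet_secAt e false hDu
  have hXu : IsUpperSet X := isUpperSet_secAt e true hAu
  have hYu : IsUpperSet Y := isUpperSet_secAt e true hBu
  have sA : A0 ⊆ X := RigidityAll.secAt_false_subset_secAt_true e hAu
  have sB : B0 ⊆ Y := RigidityAll.secAt_false_subset_secAt_true e hBu
  have sC : C0 ⊆ G := RigidityAll.secAt_false_subset_secAt_true e hDu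
  -- every event in sight ignores `e`
  have iX : ∀ ω, insert e ω ∈ X ↔ ω ∈ X := insert_mem_secAt_iff e true A
  have iY : ∀ ω, insert e ω ∈ Y ↔ ω ∈ Y := insert_mem_secAt_iff e true B
  have iG : ∀ ω, insert e ω ∈ G ↔ ω ∈ G := insert_mem_secAt_iff e true D
  have iA0 : ∀ ω, insert e ω ∈ A0 ↔ ω ∈ A0 := insert_mem_secAt_iff e false A
  have iB0 : ∀ ω, insert e ω ∈ B0 ↔ ω ∈ B0 := insert_mem_secAt_iff e false B
  have iC0 : ∀ ω, insert e ω ∈ C0 ↔ ω ∈ C0 := insert_mem_secAt_iff e false D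
  -- the set identity behind the first Harris term: `K ∩ A⁰ ∩ B⁰ = G ∩ A⁰ ∩ B⁰`
  have hKAB : K ∩ (A0 ∩ B0) = A0 ∩ B0 ∩ G := by
    ext ω
    simp only [Set.mem_inter_iff]
    constructor
    · rintro ⟨hK, hA, hB⟩
      exact ⟨⟨hA, hB⟩, hXK ⟨sA hA, hK⟩⟩
    · rintro ⟨⟨hA, hB⟩, hG⟩
      exact ⟨hGK hG, hA, hB⟩
  -- the nine comb-positive atoms
  have a1 : CombPos (update (fun _ : ι => 3) e 0) (covFun K (A0 ∩ B0)) :=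
    combPos_covFun_off e hKu (hA0u.inter hB0u) hKe (insert_mem_iff_inter e iA0 iB0)
  have a2 : CombPos (update (fun _ : ι => 3) e 0) (covFun X (B0 ∩ C0)) :=
    combPos_covFun_off e hXu (hB0u.inter hC0u) iX (insert_mem_iff_inter e iB0 iC0)
  have a3 : CombPos (update (fun _ : ι => 3) e 0) (covFun Y (A0 ∩ C0)) :=
    combPos_covFun_off e hYu (hA0u.inter hC0u) iY (insert_mem_iff_inter e iA0 iC0)
  have a4 : CombPos (update (fun _ : ι => 3) e 0) (fun p => ex (bernoulliWeight p) (ind (A0 ∩ (Y \ B0) ∩ (G \ C0)))) :=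
    combPos_ex_ind_off e (insert_mem_iff_inter e (insert_mem_iff_inter e iA0 (insert_mem_iff_sdiff e iY iB0)) (insert_mem_iff_sdiff e iG iC0))
  have a5 : CombPos (update (fun _ : ι => 3) e 0) (fun p => ex (bernoulliWeight p) (ind (B0 ∩ (X \ A0) ∩ (G \ C0)))) :=
    combPos_ex_ind_off e (insert_mem_iff_inter e (insert_mem_iff_inter e iB0 (insert_mem_iff_sdiff e iX iA0)) (insert_mem_iff_sdiff e iG iC0))
  have a6 : CombPos (update (fun _ : ι => 3) e 0) (fun p => ex (bernoulliWeight p) (ind (C0 ∩ (X \ A0) ∩ (Y \ B0)))) :=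
    combPos_ex_ind_off e (insert_mem_iff_inter e (insert_mem_iff_inter e iC0 (insert_mem_iff_sdiff e iX iA0)) (insert_mem_iff_sdiff e iY iB0))
  have a7 : CombPos (update (fun _ : ι => 3) e 0) (fun p => ex (bernoulliWeight p) (ind ((X \ A0) ∩ (Y \ B0) ∩ (G \ C0)))) :=
    combPos_ex_ind_off e (insert_mem_iff_inter e (insert_mem_iff_inter e (insert_mem_iff_sdiff e iX iA0) (insert_mem_iff_sdiff e iY iB0))
      (insert_mem_iff_sdiff e iG iC0))
  -- the hull atom `(mK − mG)·[Cov(A⁰,B⁰) + ν_Aν_B]`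
  obtain ⟨kg1, kgi⟩ := combPos_ex_sub_ex e hGK iG hKe
  obtain ⟨nA1, nAi⟩ := combPos_ex_sub_ex e sA iA0 iX
  obtain ⟨nB1, nBi⟩ := combPos_ex_sub_ex e sB iB0 iY
  have hcovAB : CombPos (fun _ : ι => 2) (covFun A0 B0) := combPos_covFun A0 B0 hA0u hB0u
  have hnn : CombPos (fun _ : ι => 2) (fun p => (ex (bernoulliWeight p) (ind X) - ex (bernoulliWeight p) (ind A0)) *
      (ex (bernoulliWeight p) (ind Y) - ex (bernoulliWeight p) (ind B0))) := nA1.mul_of_eq nB1 one_add_one_eq_two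
  have a8' : CombPos (fun _ : ι => 3) (fun p => (ex (bernoulliWeight p) (ind K) - ex (bernoulliWeight p) (ind G)) *
      (covFun A0 B0 p + (ex (bernoulliWeight p) (ind X) - ex (bernoulliWeight p) (ind A0)) *
        (ex (bernoulliWeight p) (ind Y) - ex (bernoulliWeight p) (ind B0)))) := kg1.mul_of_eq (hcovAB.add hnn) one_add_two_eq_three
  have a8 : CombPos (update (fun _ : ι => 3) e 0) (fun p => (ex (bernoulliWeight p) (ind K) - ex (bernoulliWeight p) (ind G)) *
      (covFun A0 B0 p + (ex (bernoulliWeight p) (ind X) - ex (bernoulliWeight p) (ind A0)) *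
        (ex (bernoulliWeight p) (ind Y) - ex (bernoulliWeight p) (ind B0)))) := by
    refine a8'.of_ignores e fun p s => ?_
    simp only [covFun]
    rw [kgi p s, nAi p s, nBi p s, ex_ind_update_of_iff p e s (insert_mem_iff_inter e iA0 iB0), ex_ind_update_of_iff p e s iA0,
      ex_ind_update_of_iff p e s iB0]
  have hsum := ((((((a1.add a2).add a3).add a4).add a5).add a6).add a7).add a8
  refine hsum.congr fun p => ?_
  -- the identity `M = Σ atoms` at the parameter `p`
  set m := bernoulliWeight p with hm
  have c4 := cell_inter_sdiff_sdiff m A0 sB sC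
  have c5 := cell_inter_sdiff_sdiff m B0 sA sC
  have c6 := cell_inter_sdiff_sdiff m C0 sA sB
  have c7 := cell_sdiff_sdiff_sdiff m sA sB sC
  have e1 : B0 ∩ X ∩ G = X ∩ B0 ∩ G := by ac_rfl
  have e2 : B0 ∩ X ∩ C0 = X ∩ B0 ∩ C0 := by ac_rfl
  have e3 : B0 ∩ A0 ∩ G = A0 ∩ B0 ∩ G := by ac_rfl
  have e4 : B0 ∩ A0 ∩ C0 = A0 ∩ B0 ∩ C0 := by ac_rfl
  have e5 : C0 ∩ X ∩ Y = X ∩ Y ∩ C0 := by ac_rfl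
  have e6 : C0 ∩ X ∩ B0 = X ∩ B0 ∩ C0 := by ac_rfl
  have e7 : C0 ∩ A0 ∩ Y = A0 ∩ Y ∩ C0 := by ac_rfl
  have e8 : C0 ∩ A0 ∩ B0 = A0 ∩ B0 ∩ C0 := by ac_rfl
  have e9 : X ∩ (B0 ∩ C0) = X ∩ B0 ∩ C0 := by ac_rfl
  have e10 : Y ∩ (A0 ∩ C0) = A0 ∩ Y ∩ C0 := by ac_rfl
  rw [e1, e2, e3, e4] at c5
  rw [e5, e6, e7, e8] at c6
  simp only [covFun]
  rw [hKAB, e9, e10, c4, c5, c6, c7]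
  have h4' : ex m (ind (X ∩ Y ∩ G)) = ex m (ind K) * ex m (ind X) * ex m (ind Y) := h4 p
  linear_combination (-1 : ℝ) * h4'

/-- Under the four sandwich relations the `1`-minor has `E_3 ≡ 0` (at every parameter). [this work] -/
theorem sahiE_three_secAt_true_eq_zero_of_sandwich
    (h1 : ∀ p : ι → unitInterval, ex (bernoulliWeight p) (ind (secAt e true A ∩ secAt e true B)) =
      ex (bernoulliWeight p) (ind (secAt e true A)) * ex (bernoulliWeight p) (ind (secAt e true B)))
    (h2 : ∀ p : ι → unitInterval, ex (bernoulliWeight p) (ind (secAt e true A ∩ secAt e true D)) =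
      ex (bernoulliWeight p) (ind K) * ex (bernoulliWeight p) (ind (secAt e true A)))
    (h3 : ∀ p : ι → unitInterval, ex (bernoulliWeight p) (ind (secAt e true B ∩ secAt e true D)) =
      ex (bernoulliWeight p) (ind K) * ex (bernoulliWeight p) (ind (secAt e true B)))
    (h4 : ∀ p : ι → unitInterval, ex (bernoulliWeight p) (ind (secAt e true A ∩ secAt e true B ∩ secAt e true D)) =
      ex (bernoulliWeight p) (ind K) * ex (bernoulliWeight p) (ind (secAt e true A)) * ex (bernoulliWeight p) (ind (secAt e true B)))
    (p : ι → unitInterval) :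
    sahiE (bernoulliWeight p) 3 (fun j => ind (secAt e true (![A, B, D] j))) = 0 := by
  simp only [sahiE_three_apply, Matrix.cons_val_zero, Matrix.cons_val_one, Matrix.cons_val_two, Matrix.head_cons, Matrix.tail_cons,
    ind_mul_ind_eq_inter]
  linear_combination (2 : ℝ) * h4 p - ex (bernoulliWeight p) (ind (secAt e true A)) * h3 p
    - ex (bernoulliWeight p) (ind (secAt e true B)) * h2 p - ex (bernoulliWeight p) (ind (secAt e true D)) * h1 p

/-- **`mixC2 = M` under the sandwich relations** (at every parameter). [this work] -/
theorem mixC2_eq_M_of_sandwich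
    (h1 : ∀ p : ι → unitInterval, ex (bernoulliWeight p) (ind (secAt e true A ∩ secAt e true B)) =
      ex (bernoulliWeight p) (ind (secAt e true A)) * ex (bernoulliWeight p) (ind (secAt e true B)))
    (h2 : ∀ p : ι → unitInterval, ex (bernoulliWeight p) (ind (secAt e true A ∩ secAt e true D)) =
      ex (bernoulliWeight p) (ind K) * ex (bernoulliWeight p) (ind (secAt e true A)))
    (h3 : ∀ p : ι → unitInterval, ex (bernoulliWeight p) (ind (secAt e true B ∩ secAt e true D)) =
      ex (bernoulliWeight p) (ind K) * ex (bernoulliWeight p) (ind (secAt e true B)))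
    (h4 : ∀ p : ι → unitInterval, ex (bernoulliWeight p) (ind (secAt e true A ∩ secAt e true B ∩ secAt e true D)) =
      ex (bernoulliWeight p) (ind K) * ex (bernoulliWeight p) (ind (secAt e true A)) * ex (bernoulliWeight p) (ind (secAt e true B)))
    (p : ι → unitInterval) :
    mixC2 (bernoulliWeight p) (fun j => secAt e false (![A, B, D] j)) (fun j => secAt e true (![A, B, D] j))
      = (2 * ex (bernoulliWeight p) (ind (secAt e false A ∩ secAt e false B ∩ secAt e false D))
            - ex (bernoulliWeight p) (ind (secAt e true A)) * ex (bernoulliWeight p) (ind (secAt e false B ∩ secAt e false D))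
            - ex (bernoulliWeight p) (ind (secAt e true B)) * ex (bernoulliWeight p) (ind (secAt e false A ∩ secAt e false D))
            - ex (bernoulliWeight p) (ind (secAt e true D)) * ex (bernoulliWeight p) (ind (secAt e false A ∩ secAt e false B))
            + ex (bernoulliWeight p) (ind (secAt e true A)) * ex (bernoulliWeight p) (ind (secAt e true B)) * ex (bernoulliWeight p) (ind (secAt e true D)))
          + (ex (bernoulliWeight p) (ind K) - ex (bernoulliWeight p) (ind (secAt e true D))) *
            (ex (bernoulliWeight p) (ind (secAt e true A)) *
                (ex (bernoulliWeight p) (ind (secAt e true B)) - ex (bernoulliWeight p) (ind (secAt e false B)))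
              + ex (bernoulliWeight p) (ind (secAt e true B)) *
                (ex (bernoulliWeight p) (ind (secAt e true A)) - ex (bernoulliWeight p) (ind (secAt e false A)))) := by
  simp only [mixC2, Matrix.cons_val_zero, Matrix.cons_val_one, Matrix.cons_val_two, Matrix.head_cons, Matrix.tail_cons,
    ind_mul_ind_eq_inter]
  linear_combination (-(ex (bernoulliWeight p) (ind (secAt e false A)) + ex (bernoulliWeight p) (ind (secAt e true A)))) * h3 p
    + (-(ex (bernoulliWeight p) (ind (secAt e false B)) + ex (bernoulliWeight p) (ind (secAt e true B)))) * h2 p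
    + (-(ex (bernoulliWeight p) (ind (secAt e false D)) + ex (bernoulliWeight p) (ind (secAt e true D)))) * h1 p
    + (4 : ℝ) * h4 p

/-- **COMB ORDER-1(3), TOP HALF, along `e` (unconditional on the zero-flag-`1`-minor class)**: under the sandwich data for the `1`-minor of the
increasing triple `(A, B, D)`, the middle functional `mixC2` (= 3·B₂, the layer-2 comb coefficients along `e`) is comb-positive off `e`.
Since `E_3(U¹) ≡ 0` (`sahiE_three_secAt_true_eq_zero_of_sandwich`), this is `c₂ ≥ c₃ = 0` on every comb line along `e`. [this work] -/
theorem combPos_mixC2_of_sandwich (hAu : IsUpperSet A) (hBu : IsUpperSet B) (hDu : IsUpperSet D) (hKu : IsUpperSet K)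
    (hKe : ∀ ω, insert e ω ∈ K ↔ ω ∈ K) (hGK : secAt e true D ⊆ K) (hXK : secAt e true A ∩ K ⊆ secAt e true D)
    (h1 : ∀ p : ι → unitInterval, ex (bernoulliWeight p) (ind (secAt e true A ∩ secAt e true B)) =
      ex (bernoulliWeight p) (ind (secAt e true A)) * ex (bernoulliWeight p) (ind (secAt e true B)))
    (h2 : ∀ p : ι → unitInterval, ex (bernoulliWeight p) (ind (secAt e true A ∩ secAt e true D)) =
      ex (bernoulliWeight p) (ind K) * ex (bernoulliWeight p) (ind (secAt e true A)))
    (h3 : ∀ p : ι → unitInterval, ex (bernoulliWeight p) (ind (secAt e true B ∩ secAt e true D)) =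
      ex (bernoulliWeight p) (ind K) * ex (bernoulliWeight p) (ind (secAt e true B)))
    (h4 : ∀ p : ι → unitInterval, ex (bernoulliWeight p) (ind (secAt e true A ∩ secAt e true B ∩ secAt e true D)) =
      ex (bernoulliWeight p) (ind K) * ex (bernoulliWeight p) (ind (secAt e true A)) * ex (bernoulliWeight p) (ind (secAt e true B))) :
    CombPos (update (fun _ : ι => 3) e 0)
      (fun p => mixC2 (bernoulliWeight p) (fun j => secAt e false (![A, B, D] j)) (fun j => secAt e true (![A, B, D] j))) :=
  (combPos_M_of_sandwich e A B D K hAu hBu hDu hKu hKe hGK hXK h4).congr fun p => mixC2_eq_M_of_sandwich e A B D K h1 h2 h3 h4 p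

/-- **COMB ORDER-1(3), BOTTOM HALF, along `e`**: `mixC1 − E_3(μ_p; U⁰)` (= 3B₁ − B₀ = M + ν_Aν_Bν_C) is comb-positive off `e`, unconditionally. [this work] -/
theorem combPos_mixC1_sub_of_sandwich (hAu : IsUpperSet A) (hBu : IsUpperSet B) (hDu : IsUpperSet D) (hKu : IsUpperSet K)
    (hKe : ∀ ω, insert e ω ∈ K ↔ ω ∈ K) (hGK : secAt e true D ⊆ K) (hXK : secAt e true A ∩ K ⊆ secAt e true D)
    (h1 : ∀ p : ι → unitInterval, ex (bernoulliWeight p) (ind (secAt e true A ∩ secAt e true B)) =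
      ex (bernoulliWeight p) (ind (secAt e true A)) * ex (bernoulliWeight p) (ind (secAt e true B)))
    (h2 : ∀ p : ι → unitInterval, ex (bernoulliWeight p) (ind (secAt e true A ∩ secAt e true D)) =
      ex (bernoulliWeight p) (ind K) * ex (bernoulliWeight p) (ind (secAt e true A)))
    (h3 : ∀ p : ι → unitInterval, ex (bernoulliWeight p) (ind (secAt e true B ∩ secAt e true D)) =
      ex (bernoulliWeight p) (ind K) * ex (bernoulliWeight p) (ind (secAt e true B)))
    (h4 : ∀ p : ι → unitInterval, ex (bernoulliWeight p) (ind (secAt e true A ∩ secAt e true B ∩ secAt e true D)) =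
      ex (bernoulliWeight p) (ind K) * ex (bernoulliWeight p) (ind (secAt e true A)) * ex (bernoulliWeight p) (ind (secAt e true B))) :
    CombPos (update (fun _ : ι => 3) e 0)
      (fun p => mixC1 (bernoulliWeight p) (fun j => secAt e false (![A, B, D] j)) (fun j => secAt e true (![A, B, D] j))
        - sahiE (bernoulliWeight p) 3 (fun j => ind (secAt e false (![A, B, D] j)))) := by
  have iX : ∀ ω, insert e ω ∈ secAt e true A ↔ ω ∈ secAt e true A := insert_mem_secAt_iff e true A
  have iY : ∀ ω, insert e ω ∈ secAt e true B ↔ ω ∈ secAt e true B := insert_mem_secAt_iff e true B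
  have iG : ∀ ω, insert e ω ∈ secAt e true D ↔ ω ∈ secAt e true D := insert_mem_secAt_iff e true D
  obtain ⟨nA1, nAi⟩ := combPos_ex_sub_ex e (RigidityAll.secAt_false_subset_secAt_true e hAu) (insert_mem_secAt_iff e false A) iX
  obtain ⟨nB1, nBi⟩ := combPos_ex_sub_ex e (RigidityAll.secAt_false_subset_secAt_true e hBu) (insert_mem_secAt_iff e false B) iY
  obtain ⟨nC1, nCi⟩ := combPos_ex_sub_ex e (RigidityAll.secAt_false_subset_secAt_true e hDu) (insert_mem_secAt_iff e false D) iG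
  have hN : CombPos (update (fun _ : ι => 3) e 0) (fun p =>
      (ex (bernoulliWeight p) (ind (secAt e true A)) - ex (bernoulliWeight p) (ind (secAt e false A)))
        * (ex (bernoulliWeight p) (ind (secAt e true B)) - ex (bernoulliWeight p) (ind (secAt e false B)))
        * (ex (bernoulliWeight p) (ind (secAt e true D)) - ex (bernoulliWeight p) (ind (secAt e false D)))) := by
    refine ((nA1.mul_of_eq nB1 one_add_one_eq_two).mul_of_eq nC1 two_add_one_eq_three).of_ignores e fun p s => ?_
    rw [nAi p s, nBi p s, nCi p s]
  have hM := combPos_M_of_sandwich e A B D K hAu hBu hDu hKu hKe hGK hXK h4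
  refine (hM.add hN).congr fun p => ?_
  have hid := mixC1_sub_sahiE_eq (bernoulliWeight p) (fun j => secAt e false (![A, B, D] j)) (fun j => secAt e true (![A, B, D] j))
  rw [mixC2_eq_M_of_sandwich e A B D K h1 h2 h3 h4 p, sahiE_three_secAt_true_eq_zero_of_sandwich e A B D K h1 h2 h3 h4 p] at hid
  simp only [Matrix.cons_val_zero, Matrix.cons_val_one, Matrix.cons_val_two, Matrix.head_cons, Matrix.tail_cons] at hid ⊢
  linear_combination hid

/-- **(M⁺-3) IS INHERITED along a zero-flag `1`-minor** (sandwich data form): if the `0`-minor `(A⁰, B⁰, D⁰)` is comb-positive off `e`, then the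
triple `(A, B, D)` is comb-positive at multidegree `3`. [this work] -/
theorem combPos_sahiE_three_of_sandwich (hAu : IsUpperSet A) (hBu : IsUpperSet B) (hDu : IsUpperSet D) (hKu : IsUpperSet K)
    (hKe : ∀ ω, insert e ω ∈ K ↔ ω ∈ K) (hGK : secAt e true D ⊆ K) (hXK : secAt e true A ∩ K ⊆ secAt e true D)
    (h1 : ∀ p : ι → unitInterval, ex (bernoulliWeight p) (ind (secAt e true A ∩ secAt e true B)) =
      ex (bernoulliWeight p) (ind (secAt e true A)) * ex (bernoulliWeight p) (ind (secAt e true B)))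
    (h2 : ∀ p : ι → unitInterval, ex (bernoulliWeight p) (ind (secAt e true A ∩ secAt e true D)) =
      ex (bernoulliWeight p) (ind K) * ex (bernoulliWeight p) (ind (secAt e true A)))
    (h3 : ∀ p : ι → unitInterval, ex (bernoulliWeight p) (ind (secAt e true B ∩ secAt e true D)) =
      ex (bernoulliWeight p) (ind K) * ex (bernoulliWeight p) (ind (secAt e true B)))
    (h4 : ∀ p : ι → unitInterval, ex (bernoulliWeight p) (ind (secAt e true A ∩ secAt e true B ∩ secAt e true D)) =
      ex (bernoulliWeight p) (ind K) * ex (bernoulliWeight p) (ind (secAt e true A)) * ex (bernoulliWeight p) (ind (secAt e true B)))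
    (h0 : CombPos (update (fun _ : ι => 3) e 0) (fun p => sahiE (bernoulliWeight p) 3 (fun j => ind (secAt e false (![A, B, D] j))))) :
    CombPos (fun _ : ι => 3) (fun p => sahiE (bernoulliWeight p) 3 (fun j => ind ((![A, B, D]) j))) := by
  set V : Fin 3 → Set (Set ι) := ![A, B, D] with hV
  have hVu : ∀ j, IsUpperSet (V j) := by
    intro j; fin_cases j
    · exact hAu
    · exact hBu
    · exact hDu
  have hP : ∀ (j : Fin 3) (b : Bool), secAt e b (secAt e false (V j)) = secAt e false (V j) := fun j b => secAt_secAt_same e b false (V j)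
  have hQ : ∀ (j : Fin 3) (b : Bool), secAt e b (secAt e true (V j)) = secAt e true (V j) := fun j b => secAt_secAt_same e b true (V j)
  have hPQ : ∀ j, secAt e false (V j) ⊆ secAt e true (V j) := fun j => RigidityAll.secAt_false_subset_secAt_true e (hVu j)
  have hC1 : CombPos (update (fun _ : ι => 3) e 0)
      (fun p => mixC1 (bernoulliWeight p) (fun j => secAt e false (V j)) (fun j => secAt e true (V j))) :=
    (h0.add (combPos_mixC1_sub_of_sandwich e A B D K hAu hBu hDu hKu hKe hGK hXK h1 h2 h3 h4)).congr fun p => by ring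
  have hC2 := combPos_mixC2_of_sandwich e A B D K hAu hBu hDu hKu hKe hGK hXK h1 h2 h3 h4
  have hE1 : CombPos (update (fun _ : ι => 3) e 0) (fun p => sahiE (bernoulliWeight p) 3 (fun j => ind (secAt e true (V j)))) :=
    (CombPos.zero _).congr fun p => sahiE_three_secAt_true_eq_zero_of_sandwich e A B D K h1 h2 h3 h4 p
  have h := combPos_three_mixCoord_of_coeffs e (fun j => secAt e false (V j)) (fun j => secAt e true (V j)) hP hQ hPQ h0 hC1 hC2 hE1
  refine h.congr fun p => ?_
  have hfam : (fun j => ind (mixCoord e (secAt e false (V j)) (secAt e true (V j)))) = fun j => ind (V j) := by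
    funext j; rw [mixCoord_secAt_eq e (hVu j)]
  rw [hfam]

end Sandwich

end Pointwise

end Summit.CriticalPhenomena.PercolationContinuityZ3.Theorems

end
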